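import Summits.BirchSwinnertonDyer.BirchSwinnertonDyer.Theorems.PrintCf2RamifiedOffTYZGenusPeriodNormClass
import Summits.BirchSwinnertonDyer.BirchSwinnertonDyer.Theorems.PrintCf2RamifiedOffTYZGenusPeriodR2
import Summits.BirchSwinnertonDyer.Rank1Residual.P2.CongruentNumberSilentEvenFiveThetaFourTorsion
import HarnessLib

/-!
# THE LAW GP0 FROM THE NORM: if the Φ-norm of `x(z) − 2i` avoids the six torsion square-classes in `M`, the genus period is NOT `2`-divisible —
# and on the visible R2 rows that IS C⁺ (crux stmt-BirchSwinnertonDyer-20509 `RamifiedOffTYZOfFacts`, line `offtyz-v7`, LEAD g26, cycle 27, part 7)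

HONEST FRAMING (cell `bsd-print-cf2`, route `PrintCf2`; `--supports stmt-BirchSwinnertonDyer-20509`; theorems only, `def`-free, no `sorry`).
BSD is not proved by any of this; no class is closed by this file; item 23431 (C⁺) and crux 20509 stay OPEN.

Part 6 (`…GenusPeriodNormClass`, p790023): for a seven-block `d` of `n`, read in the extension `M ⊇ ℍ′_n` of the display
`CMPointSevenBlockDisplays`, the `2`-descent class of the genus period at `T⁺ = (2i, 0)` is `κ_M(ι Z(d)) = [N]`, `N = ∏_{t∈Φ} (t x₀ − 2i)` (the
Φ-norm of the CM value of the level-32 unit `x − 2i`).  THIS FILE turns it into a CRITERION for the layer-one law of the line: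

* §1 torsion square-classes in `M`: the images in `A(M)` of the torsion of `A(ℍ′_n)` (`n` odd: Lemma 3.18, `A(ℍ′_n)_tor ⊆ A[(1+i)³]`) have
  `T⁺`-classes among **`[1], [−2i], [−8], [−4i], [2 − 2i], [−2 − 2i]`** (`δ` of `O, (0,0), (±2i,0), (±2, ·)`; Silverman X.1.4).
* §2 ★★★ `sqClass_norm_mem_torsionClasses_of_twoDivisible` — if `Z(d) ∈ 2A(ℍ′_n) + A(ℍ′_n)_tor` then `[N]` is one of the six classes (in `M`);
  contrapositively ★★★ `genusPeriod_not_twoDivisible_of_norm` — **if `N·w` is a non-square in `M` for each of the six `w`, then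
  `Z(d) ∉ 2A(ℍ′_n) + tors`** (the law GP0 at `d`).
* §3 ★★★ `levelTwo_of_norm_nonsquare_visible_R2` — BY NAME (conjuncts 1, 2, 4, 5 of 𝔅_ram + the one display fact `tyz_sevenBlockCMData`): on an R2
  row `n = lq` (`ord L(E_n) = 1`) with a VISIBLE generator (`X(h) ∉ 2ℚ^{×2}`), the six non-square conditions on `N` in `M` IMPLY the conclusion of C⁺
  at `lq` (part 4: visible ⟹ (C⁺ ⟺ `Z ∉ 2A + tors`)).

So on the visible / partner-trivial rows of R2 (105 of the census's 122) C⁺ is now implied by an explicit statement about ONE algebraic number: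
«`N_{H_n(i)/L_n(i)}(x(z_n) − 2i)·w ∉ (H_n(i)ℍ′_n)^{×2}` for the six torsion classes `w`» — the target of the inputs (U1)–(U3) (η-quotient form of
`x − 2i`, Shimura reciprocity, a genus Kronecker-limit evaluation).  The census law K1 (g19: `κ(Z(lq)) ≡ (1, [π_l])` mod `κ(T)` on the visible `ρ = 0`
rows) predicts `[N] = [π_l]·[w]`, and `π_l·w` is expected to be a non-square in `M`.  No print decides it.

References: [cite: TianYuanZhang2017, §3.1 (p0011 L53–L66), §3.2 (p0012 L8–L18), Lemma 3.16 (p0017 L98–L113), Lemma 3.18 (p0017 L152–L153)];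
[cite: SilvermanAEC2009, Prop. X.1.4]; tree: part 6, part 4 (`…GenusPeriodR2`), `TianYuanZhang2017/CurveAFourTorsion` (`eq_of_two_nsmul_eq_zero`),
`Rank1Residual/P2/CongruentNumberSilentEvenFiveThetaFourTorsion` (`ThetaDescent.eq_of_two_nsmul_eq_tauOne`).
-/

noncomputable section

open scoped Classical

open WeierstrassCurve WeierstrassCurve.Affine WeierstrassCurve.Affine.Point
  Literature.NumberTheory.EllipticCurves Literature.NumberTheory.EllipticCurves.Rank1Residual
  Summit.BirchSwinnertonDyer.Rank1Residual
  Literature.NumberTheory.EllipticCurves.TianYuanZhang2017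
  Literature.NumberTheory.EllipticCurves.TianYuanZhang2017.W2
  Literature.NumberTheory.EllipticCurves.TianYuanZhang2017.GenusPointData
  Summit.BirchSwinnertonDyer.PrintCf2.GenusPeriodNorm

set_option autoImplicit false

namespace Summit.BirchSwinnertonDyer.PrintCf2.GenusPeriodNormCriterion

/-! ## §1 The `T⁺`-classes of `A[(1+i)³]` in `M` -/

section TorsionClasses

variable {M : Type} [Field M] [NumberField M]

/-- `A/M` is an elliptic curve (instance plumbing). [folklore] -/
private theorem isElliptic_curveA_baseChange_M : (curveA.baseChange M).IsElliptic :=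
  inferInstanceAs (curveA.map (algebraMap ℚ M)).IsElliptic

/-- The `T⁺`-component kills `2A(M)`: `δ(P + 2y) = δ(P)`. [cite: SilvermanAEC2009, Prop. X.1.4] -/
theorem twoDescentComponent_add_two_zsmul {im : M} (him : im ^ 2 = -1) (P y : APoint M) :
    twoDescentComponent (curveA.baseChange M).toAffine (2 * im) 0 (-(2 * im)) (P + (2 : ℤ) • y) =
      twoDescentComponent (curveA.baseChange M).toAffine (2 * im) 0 (-(2 * im)) P := by
  haveI := isElliptic_curveA_baseChange_M (M := M)
  have h := splitTwoTorsion_over him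
  rw [two_zsmul, twoDescentComponent_add h, twoDescentComponent_add h, SqUnits.mul_self, SqUnits.mul_one]

/-- **`δ` on the points `T` with `2T = 0`**: `[1], [−2i], [−8], [−4i]`. [cite: SilvermanAEC2009, Prop. X.1.4] [cite: TianYuanZhang2017, Lemma 3.16 (p0017 L98–L101)] -/
theorem twoDescentComponent_of_two_nsmul_eq_zero {im : M} (him : im ^ 2 = -1) {T : APoint M} (hT : (2 : ℕ) • T = 0) :
    twoDescentComponent (curveA.baseChange M).toAffine (2 * im) 0 (-(2 * im)) T = sqClass (1 : M) ∨
      twoDescentComponent (curveA.baseChange M).toAffine (2 * im) 0 (-(2 * im)) T = sqClass (-(2 * im)) ∨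
      twoDescentComponent (curveA.baseChange M).toAffine (2 * im) 0 (-(2 * im)) T = sqClass (-8 : M) ∨
      twoDescentComponent (curveA.baseChange M).toAffine (2 * im) 0 (-(2 * im)) T = sqClass (-(4 * im)) := by
  have hi0 : im ≠ 0 := fun h => by rw [h] at him; norm_num at him
  have h11 : sqClass (1 : M) = 1 := by simpa using sqClass_mul_self (1 : M)
  rcases TianYuanZhang2017.eq_of_two_nsmul_eq_zero im him hT with rfl | rfl | rfl | rfl
  · left; rw [twoDescentComponent_zero, h11]
  · right; left
    have hx : (0 : M) ≠ 2 * im := fun h => hi0 (by linear_combination (-1/2 : M) * h)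
    rw [tauOne, twoDescentComponent_some_of_ne _ hx, zero_sub]
  · right; right; left
    rw [ptTwoI, twoDescentComponent_some_of_eq _ rfl]
    congr 1
    linear_combination (8 : M) * him
  · right; right; right
    have hx : -(2 * im) ≠ 2 * im := fun h => hi0 (by linear_combination (-1/4 : M) * h)
    rw [ptNegTwoI, twoDescentComponent_some_of_ne _ hx]
    congr 1; ring

/-- **`δ` on the points `T` with `2T = τ(1)`** (`(2, ±4), (−2, ±4i)`): `[2 − 2i]` or `[−2 − 2i]`. [cite: SilvermanAEC2009, Prop. X.1.4]
[cite: TianYuanZhang2017, §3.2 (p0012 L12–L18), Lemma 3.16 (p0017 L98–L113)] -/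
theorem twoDescentComponent_of_two_nsmul_eq_tauOne {im : M} (him : im ^ 2 = -1) {T : APoint M} (hT : (2 : ℕ) • T = tauOne) :
    twoDescentComponent (curveA.baseChange M).toAffine (2 * im) 0 (-(2 * im)) T = sqClass (2 - 2 * im) ∨
      twoDescentComponent (curveA.baseChange M).toAffine (2 * im) 0 (-(2 * im)) T = sqClass (-2 - 2 * im) := by
  have h2 : (2 : M) ≠ 2 * im := by
    intro h
    have : im = 1 := by linear_combination (-1/2 : M) * h
    rw [this] at him; norm_num at him
  have hm2 : (-2 : M) ≠ 2 * im := by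
    intro h
    have : im = -1 := by linear_combination (-1/2 : M) * h
    rw [this] at him; norm_num at him
  have hτ : twoDescentComponent (curveA.baseChange M).toAffine (2 * im) 0 (-(2 * im)) tauHalf = sqClass (2 - 2 * im) := by
    rw [tauHalf, twoDescentComponent_some_of_ne _ h2]
  have hiτ : twoDescentComponent (curveA.baseChange M).toAffine (2 * im) 0 (-(2 * im)) (cmI im him tauHalf) = sqClass (-2 - 2 * im) := by
    rw [tauHalf, cmI_some, twoDescentComponent_some_of_ne _ hm2]
  rcases P2.ThetaDescent.eq_of_two_nsmul_eq_tauOne im him T hT with rfl | rfl | rfl | rfl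
  · exact Or.inl hτ
  · left; rw [twoDescentComponent_neg]; exact hτ
  · exact Or.inr hiτ
  · right; rw [twoDescentComponent_neg]; exact hiτ

end TorsionClasses

/-! ## §2 If the genus period is `2`-divisible modulo torsion, the norm class is a torsion class -/

section Criterion

variable {n : ℕ} {M : Type} [Field M] [NumberField M]

/-- `ι` sends `τ(1) = (0,0)` to `τ(1)`. [folklore] -/
theorem map_tauOne (D : GenusPointData n) (ι : D.H →ₐ[ℚ] M) : Point.map (W' := curveA) ι (tauOne : APoint D.H) = tauOne := by
  rw [tauOne, Point.map_some, tauOne]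
  congr 1 <;> exact _root_.map_zero ι

/-- ★★★ **`Z(d) ∈ 2A(ℍ′_n) + tors ⟹ [N] is a torsion class in `M`.**  Odd `n`, `D` with Lemma 3.18 (`lemma318`), the seven-block data of `d` over
`M` ((S1), (S2)); if `Z(d) − 2y` has finite order for some `y ∈ A(ℍ′_n)`, then the class of `N = ∏_{t∈Φ}(t x₀ − 2i)` in `M^×/M^{×2}` is one of
`[1], [−2i], [−8], [−4i], [2 − 2i], [−2 − 2i]`. [cite: TianYuanZhang2017, Lemma 3.18 (p0017 L152–L153), Lemma 3.16, §3.1 (p0011 L53–L56)] [cite: SilvermanAEC2009, Prop. X.1.4] -/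
theorem sqClass_norm_mem_torsionClasses_of_twoDivisible (D : GenusPointData n) (hodd : Odd n) (h318 : D.lemma318) {d : ℕ}
    (ι : D.H →ₐ[ℚ] M) {x₀ y₀ : M} (h₀ : (curveA.baseChange M).toAffine.Nonsingular x₀ y₀) (Φ : Finset (M ≃ₐ[ℚ] M))
    (hS1 : Point.map (W' := curveA) ι (D.Z d) = ∑ t ∈ Φ, galPtOver M t (.some x₀ y₀ h₀))
    (hS2 : ∀ t ∈ Φ, ¬ ((2 : ℕ) • galPtOver M t (.some x₀ y₀ h₀) = 0 ∨ (2 : ℕ) • galPtOver M t (.some x₀ y₀ h₀) = tauOne))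
    (h2 : ∃ y : APoint D.H, IsOfFinAddOrder (D.Z d - (2 : ℤ) • y)) :
    let N := ∏ t ∈ Φ, ((t : M ≃ₐ[ℚ] M) x₀ - 2 * ι D.im)
    sqClass N = sqClass (1 : M) ∨ sqClass N = sqClass (-(2 * ι D.im)) ∨ sqClass N = sqClass (-8 : M) ∨
      sqClass N = sqClass (-(4 * ι D.im)) ∨ sqClass N = sqClass (2 - 2 * ι D.im) ∨ sqClass N = sqClass (-2 - 2 * ι D.im) := by
  intro N
  have him : (ι D.im) ^ 2 = -1 := by rw [← map_pow, D.im_sq, map_neg, map_one]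
  obtain ⟨y, hy⟩ := h2
  set t₀ : APoint D.H := D.Z d - (2 : ℤ) • y with ht₀
  obtain ⟨-, h2t⟩ := h318.1 hodd t₀ hy
  -- push to `M`
  set T : APoint M := Point.map (W' := curveA) ι t₀ with hT
  have hZ : Point.map (W' := curveA) ι (D.Z d) = T + (2 : ℤ) • Point.map (W' := curveA) ι y := by
    rw [hT, ht₀, map_sub, map_zsmul, sub_add_cancel]
  -- `[N] = δ_M(ι Z) = δ_M(T)`
  have hne : ∀ t ∈ Φ, (t : M ≃ₐ[ℚ] M) x₀ - 2 * ι D.im ≠ 0 := by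
    intro t ht
    have h2' : (2 : ℕ) • galPtOver M t (.some x₀ y₀ h₀) ≠ 0 := fun h0 => hS2 t ht (Or.inl h0)
    rw [galPtOver_some t h₀] at h2'
    exact sub_ne_zero.mpr (X_ne_of_two_smul_ne_zero him _ h2').1
  have hN : sqClass N = twoDescentComponent (curveA.baseChange M).toAffine (2 * ι D.im) 0 (-(2 * ι D.im)) T := by
    rw [sqClass_prod_of_ne_zero Φ _ hne, ← twoDescentComponent_genusPeriod_eq_prod_two_im D ι h₀ Φ hS1 hS2, hZ,
      twoDescentComponent_add_two_zsmul him]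
  rw [hN]
  rcases h2t with h0 | h1
  · have hT0 : (2 : ℕ) • T = 0 := by rw [hT, ← map_nsmul, h0, _root_.map_zero]
    rcases twoDescentComponent_of_two_nsmul_eq_zero him hT0 with e | e | e | e
    · exact Or.inl e
    · exact Or.inr (Or.inl e)
    · exact Or.inr (Or.inr (Or.inl e))
    · exact Or.inr (Or.inr (Or.inr (Or.inl e)))
  · have hT1 : (2 : ℕ) • T = tauOne := by rw [hT, ← map_nsmul, h1, map_tauOne]
    rcases twoDescentComponent_of_two_nsmul_eq_tauOne him hT1 with e | e
    · exact Or.inr (Or.inr (Or.inr (Or.inr (Or.inl e))))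
    · exact Or.inr (Or.inr (Or.inr (Or.inr (Or.inr e))))

/-- `[a] = [w]` with `a, w ≠ 0` ⟹ `a·w` is a square. [folklore] -/
theorem isSquare_mul_of_sqClass_eq {F : Type*} [Field F] {a w : F} (ha : a ≠ 0) (hw : w ≠ 0) (h : sqClass a = sqClass w) :
    IsSquare (a * w) := by
  have h1 : sqClass (a * w) = 1 := by rw [sqClass_mul ha hw, h, SqUnits.mul_self]
  obtain ⟨s, hs⟩ := (sqClass_eq_one_iff (mul_ne_zero ha hw)).mp h1
  exact ⟨s, by rw [hs, sq]⟩

/-- ★★★ **THE LAW GP0 FROM THE NORM.**  Odd `n`, `D` with Lemma 3.18, the seven-block data of `d` over `M`; `N = ∏_{t∈Φ}(t x₀ − 2i)`.  If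
**`N·w` is NOT a square in `M` for each `w ∈ {1, −2i, −8, −4i, 2 − 2i, −2 − 2i}`**, then **`Z(d) ∉ 2A(ℍ′_n) + A(ℍ′_n)_tor`.**
[cite: TianYuanZhang2017, Lemma 3.18, Lemma 3.16, §3.1 (p0011 L53–L56)] [cite: SilvermanAEC2009, Prop. X.1.4] -/
theorem genusPeriod_not_twoDivisible_of_norm (D : GenusPointData n) (hodd : Odd n) (h318 : D.lemma318) {d : ℕ}
    (ι : D.H →ₐ[ℚ] M) {x₀ y₀ : M} (h₀ : (curveA.baseChange M).toAffine.Nonsingular x₀ y₀) (Φ : Finset (M ≃ₐ[ℚ] M))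
    (hS1 : Point.map (W' := curveA) ι (D.Z d) = ∑ t ∈ Φ, galPtOver M t (.some x₀ y₀ h₀))
    (hS2 : ∀ t ∈ Φ, ¬ ((2 : ℕ) • galPtOver M t (.some x₀ y₀ h₀) = 0 ∨ (2 : ℕ) • galPtOver M t (.some x₀ y₀ h₀) = tauOne))
    (hns : ∀ w ∈ ({1, -(2 * ι D.im), -8, -(4 * ι D.im), 2 - 2 * ι D.im, -2 - 2 * ι D.im} : Finset M),
      ¬ IsSquare ((∏ t ∈ Φ, ((t : M ≃ₐ[ℚ] M) x₀ - 2 * ι D.im)) * w)) :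
    ¬ ∃ y : APoint D.H, IsOfFinAddOrder (D.Z d - (2 : ℤ) • y) := by
  intro h2
  have him : (ι D.im) ^ 2 = -1 := by rw [← map_pow, D.im_sq, map_neg, map_one]
  have hi0 : ι D.im ≠ 0 := fun h => by rw [h] at him; norm_num at him
  have hne : ∀ t ∈ Φ, (t : M ≃ₐ[ℚ] M) x₀ - 2 * ι D.im ≠ 0 := by
    intro t ht
    have h2' : (2 : ℕ) • galPtOver M t (.some x₀ y₀ h₀) ≠ 0 := fun h0 => hS2 t ht (Or.inl h0)
    rw [galPtOver_some t h₀] at h2'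
    exact sub_ne_zero.mpr (X_ne_of_two_smul_ne_zero him _ h2').1
  have hN0 : (∏ t ∈ Φ, ((t : M ≃ₐ[ℚ] M) x₀ - 2 * ι D.im)) ≠ 0 := Finset.prod_ne_zero_iff.mpr hne
  -- the six candidates are non-zero
  have w2 : (2 - 2 * ι D.im : M) ≠ 0 := by
    intro h
    have : ι D.im = 1 := by linear_combination (-1/2 : M) * h
    rw [this] at him; norm_num at him
  have wm2 : (-2 - 2 * ι D.im : M) ≠ 0 := by
    intro h
    have : ι D.im = -1 := by linear_combination (-1/2 : M) * h
    rw [this] at him; norm_num at him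
  have key := sqClass_norm_mem_torsionClasses_of_twoDivisible D hodd h318 ι h₀ Φ hS1 hS2 h2
  simp only at key
  rcases key with e | e | e | e | e | e
  · exact hns 1 (by simp) (isSquare_mul_of_sqClass_eq hN0 one_ne_zero e)
  · exact hns _ (by simp) (isSquare_mul_of_sqClass_eq hN0 (neg_ne_zero.mpr (mul_ne_zero two_ne_zero hi0)) e)
  · exact hns (-8) (by simp) (isSquare_mul_of_sqClass_eq hN0 (by norm_num) e)
  · exact hns _ (by simp) (isSquare_mul_of_sqClass_eq hN0 (neg_ne_zero.mpr (mul_ne_zero (by norm_num) hi0)) e)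
  · exact hns _ (by simp) (isSquare_mul_of_sqClass_eq hN0 w2 e)
  · exact hns _ (by simp) (isSquare_mul_of_sqClass_eq hN0 wm2 e)

end Criterion

/-! ## §3 By name on R2: the six non-square conditions IMPLY C⁺ on the visible rows -/

section R2

variable {n : ℕ}

/-- ★★★ **C⁺ FROM THE NORM, VISIBLE R2 ROWS, BY NAME.**  Granted conjuncts 1, 2, 4, 5 of 𝔅_ram and the display fact `tyz_sevenBlockCMData`: for primes
`l ≡ 1`, `q ≡ 7 (mod 8)`, `n = lq` with `ord_{s=1} L(E_n, s) = 1`, there is a display package `D` of `n` with its seven-block data (`M ⊇ ℍ′_n`, the CM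
point `z = (x₀, y₀)`, `Φ` with `#Φ = g(n)`, `ι(Z(lq)) = Σ_{t∈Φ} z^t`) such that: **if the A_n-generator `h = (X, Y)` is VISIBLE (`X ∉ 2ℚ^{×2}`) and the
Φ-norm `N = ∏_{t∈Φ}(t x₀ − 2i)` has `N·w` a non-square in `M` for the six torsion classes `w`, then the conclusion of C⁺ holds at `lq`**
(`2 ∥ L` for every `L` with `𝓛(lq)² = L²`).  [cite: TianYuanZhang2017, §3.1, §3.2, Thm. 3.5, Lemma 3.16, Lemma 3.18, Thm. 1.2]
[cite: SilvermanAEC2009, Prop. X.1.4] [cite: BurungaleFlach2024, Thm 1.1 / Cor. 3] [cite: Darmon2004, Thm. 3.22] -/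
theorem levelTwo_of_norm_nonsquare_visible_R2 (hGZK : rank_eq_analyticRank_of_analyticRank_le_one)
    (hmod : WeierstrassCurve.hasEntireLFunction_rat) (hCM0 : bsdTriple_of_hasCM_of_L_one_ne_zero) (h12 : thm12_parity_of_scriptL')
    (hT : tyz_sevenBlockCMData) {l q : ℕ} (hl : l.Prime) (hq : q.Prime) (hl8 : l % 8 = 1) (hq8 : q % 8 = 7) (hn : n = l * q)
    (hr : (congruentNumberCurve n).analyticRank = 1) :
    ∃ D : GenusPointData n, D.Printed ∧ D.CMPointCompositumPrinted ∧ D.Thm35AtBlocks ∧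
      ∃ (M : Type) (_ : Field M) (_ : NumberField M) (_ : IsGalois ℚ M) (ι : D.H →ₐ[ℚ] M) (x₀ y₀ : M)
        (h₀ : (curveA.baseChange M).toAffine.Nonsingular x₀ y₀) (Φ : Finset (M ≃ₐ[ℚ] M)),
        Φ.card = gK n ∧ Point.map (W' := curveA) ι (D.Z n) = ∑ t ∈ Φ, galPtOver M t (.some x₀ y₀ h₀) ∧
        ∀ {X Y : ℚ} (h : (Atwo n).toAffine.Nonsingular X Y), (¬ ∃ s : ℚ, X = 2 * s ^ 2) →
          (∀ P : (Atwo n).toAffine.Point, ∃ m : ℤ, IsOfFinAddOrder (P - m • (Point.some X Y h : (Atwo n).toAffine.Point))) →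
          (∀ w ∈ ({1, -(2 * ι D.im), -8, -(4 * ι D.im), 2 - 2 * ι D.im, -2 - 2 * ι D.im} : Finset M),
            ¬ IsSquare ((∏ t ∈ Φ, ((t : M ≃ₐ[ℚ] M) x₀ - 2 * ι D.im)) * w)) →
          ∀ L : ℤ, IsScriptL n L → (2 : ℤ) ∣ L ∧ ¬ (4 : ℤ) ∣ L := by
  have hmod8 : n % 8 = 7 := by rw [hn, Nat.mul_mod, hl8, hq8]
  have hsq : Squarefree n := by
    subst hn
    have hne : l ≠ q := fun h => by subst h; omega
    exact Nat.squarefree_mul_iff.mpr ⟨(Nat.coprime_primes hl hq).mpr hne, hl.squarefree, hq.squarefree⟩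
  have hodd : Odd n := Nat.odd_iff.mpr (by omega)
  obtain ⟨D, hPr, hC, hBl, hS⟩ := hT n hsq (Or.inr (Or.inr hmod8))
  obtain ⟨M, iF, iN, iG, ι, z, Φ, ⟨hS1, hcard⟩, hS2, -⟩ := hS n (Nat.mem_divisors_self n hsq.ne_zero) hmod8
  have hΦ : Φ.Nonempty := Finset.card_pos.mp (by rw [hcard]; exact gK_pos n)
  obtain ⟨t₀, ht₀⟩ := hΦ
  have hz : z ≠ 0 := by
    intro hz
    apply galPtOver_ne_zero_of_not_cusp hS2 ht₀
    rw [hz, _root_.map_zero]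
  rcases z with _ | ⟨x₀, y₀, h₀⟩
  · exact absurd rfl hz
  refine ⟨D, hPr, hC, hBl, M, iF, iN, iG, ι, x₀, y₀, h₀, Φ, hcard, hS1, fun h hX hgen hns => ?_⟩
  have hnot := genusPeriod_not_twoDivisible_of_norm D hodd hPr.2.2.2.2.2.2.2.2.1 ι h₀ Φ hS1 hS2 hns
  exact (GenusPeriodR2.levelTwo_iff_genusPeriod_not_twoDivisible_of_visible hGZK hmod hCM0 h12 hl hq hl8 hq8 hn hr D hPr hC hBl h hX
    hgen).mpr hnot

end R2

end Summit.BirchSwinnertonDyer.PrintCf2.GenusPeriodNormCriterion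

end
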